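import Mathlib.RingTheory.MvPowerSeries.Order
import Mathlib.RingTheory.Ideal.Operations
import HarnessLib

/-!
# [OURS · L1 W4.2 · D14 ROUTE G v2 «ARC LIMIT» · G2c, file 1] The `y`-degree filtration of `K⟦t, y_1, …, y_d⟧`

Sub-problem `ResolutionOfSingularities`, crux `SigmaMaxModifications` / conjunct `SigmaMaxModificationsCorridor3`
(route `HilbertSamuelElimination`, line `w_ladder`), idea chain L1 C5 «K1 FREE-RATIONAL TAILS», ROUTE G v2 (plan of record
RULING v3.14-20 (FO); memo `L/res-L1-w42-lead-1/ROUTE-G-ARCLIMIT.md` 96c77a196e17bc23).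

The common formal frame of a free-rational tail is `S = K⟦X_0, X_1, …, X_d⟧` with `t = X 0` the exceptional parameter and the
(sheared) arc `P₀ = (X_1, …, X_d)`.  This file is the bookkeeping of the `P₀`-adic filtration by COEFFICIENTS, at every `d`
(the ROUTE-H file `…IsoTailsArcDivisibility` did `d = 3` by hand):

* `yW`, `yDeg` — the weight `(0, 1, …, 1)` and the `y`-degree `|b|` of an exponent `(a, b)`;
* `arcIdeal d K = P₀`, `degGE d K j` and **`mem_arcIdeal_pow_iff`** / `arcIdeal_pow_eq_degGE`: `g ∈ P₀^j ↔` every monomial of `g`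
  has `y`-degree `≥ j` (the decomposition `h = Σ X_i · part h i` drives the induction).

Everything is OURS, elementary coefficient algebra over any commutative ring `K`; no statement of the manuscript under adjudication
and no published theorem is asserted. [cite: CossartPiltant2009, ch. 3 I.9 (formal arcs; the d = 3 hypersurface computation)]
-/

set_option linter.dupNamespace false -- mandated namespace of this single-conjunct summit
open MvPowerSeries
open Finsupp hiding some

noncomputable section

universe u

namespace Summit.ResolutionOfSingularities.ResolutionOfSingularities.Cruxes.SigmaMaxModifications.IdeasL1C5

namespace ArcLimit

variable {d : ℕ} {K : Type u} [CommRing K]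

/-! ### §1. `y`-degree -/

/-- The weight `(0, 1, …, 1)`: `t = X 0` weighs `0`, every `y_i = X i.succ` weighs `1`. [folklore] -/
def yW (d : ℕ) : Fin (d + 1) → ℕ := fun i => if i = 0 then 0 else 1

/-- The `y`-degree `|b|` of an exponent `(a, b) : Fin (d+1) →₀ ℕ`. [folklore] -/
def yDeg (e : Fin (d + 1) →₀ ℕ) : ℕ := weight (yW d) e

/-- [OURS · L1 W4.2] `yW_zero` — y-degree / arc-ideal bookkeeping. [folklore] -/
theorem yW_zero : yW d 0 = 0 := by simp [yW]

/-- [OURS · L1 W4.2] `yW_succ` — y-degree / arc-ideal bookkeeping. [folklore] -/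
theorem yW_succ (i : Fin d) : yW d i.succ = 1 := by simp [yW, Fin.succ_ne_zero]

/-- [OURS · L1 W4.2] `yW_of_ne_zero` — y-degree / arc-ideal bookkeeping. [folklore] -/
theorem yW_of_ne_zero {i : Fin (d + 1)} (hi : i ≠ 0) : yW d i = 1 := by simp [yW, hi]

/-- `|b| = Σ_{i ≠ 0} e_i`. [folklore] -/
theorem yDeg_eq_sum (e : Fin (d + 1) →₀ ℕ) : yDeg e = ∑ i : Fin d, e i.succ := by
  classical
  rw [yDeg, weight_apply, Finsupp.sum_fintype _ _ (fun i => by simp)]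
  rw [Fin.sum_univ_succ]
  simp [yW_zero, yW_succ]

/-- [OURS · L1 W4.2] `yDeg_add` — y-degree / arc-ideal bookkeeping. [folklore] -/
@[simp] theorem yDeg_add (e e' : Fin (d + 1) →₀ ℕ) : yDeg (e + e') = yDeg e + yDeg e' := by
  simp [yDeg, map_add]

/-- [OURS · L1 W4.2] `yDeg_single_zero` — y-degree / arc-ideal bookkeeping. [folklore] -/
@[simp] theorem yDeg_single_zero (k : ℕ) : yDeg (single (0 : Fin (d + 1)) k) = 0 := by
  classical
  simp [yDeg, weight_single, yW_zero]

/-- [OURS · L1 W4.2] `yDeg_single_of_ne_zero` — y-degree / arc-ideal bookkeeping. [folklore] -/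
@[simp] theorem yDeg_single_of_ne_zero {i : Fin (d + 1)} (hi : i ≠ 0) (k : ℕ) : yDeg (single i k) = k := by
  classical
  simp [yDeg, weight_single, yW_of_ne_zero hi]

/-- [OURS · L1 W4.2] `yDeg_single_succ` — y-degree / arc-ideal bookkeeping. [folklore] -/
theorem yDeg_single_succ (i : Fin d) (k : ℕ) : yDeg (single i.succ k) = k :=
  yDeg_single_of_ne_zero (Fin.succ_ne_zero i) k

/-- An exponent of positive `y`-degree involves some `y`-variable. [folklore] -/
theorem exists_succ_ne_zero_of_yDeg_pos {e : Fin (d + 1) →₀ ℕ} (he : 0 < yDeg e) : ∃ i : Fin d, e i.succ ≠ 0 := by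
  by_contra h
  push Not at h
  rw [yDeg_eq_sum] at he
  simp [h] at he

/-! ### §2. The arc ideal `P₀ = (y_1, …, y_d)` and its powers, by coefficients -/

variable (d K) in
/-- The (sheared) ARC IDEAL `P₀ = (X_1, …, X_d) ⊂ K⟦X_0, …, X_d⟧`. [folklore] -/
def arcIdeal : Ideal (MvPowerSeries (Fin (d + 1)) K) :=
  Ideal.span (Set.range fun i : Fin d => (X i.succ : MvPowerSeries (Fin (d + 1)) K))

/-- [OURS · L1 W4.2] `X_succ_mem_arcIdeal` — y-degree / arc-ideal bookkeeping. [folklore] -/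
theorem X_succ_mem_arcIdeal (i : Fin d) : (X i.succ : MvPowerSeries (Fin (d + 1)) K) ∈ arcIdeal d K :=
  Ideal.subset_span ⟨i, rfl⟩

/-- [OURS · L1 W4.2] `X_mem_arcIdeal` — y-degree / arc-ideal bookkeeping. [folklore] -/
theorem X_mem_arcIdeal {i : Fin (d + 1)} (hi : i ≠ 0) : (X i : MvPowerSeries (Fin (d + 1)) K) ∈ arcIdeal d K := by
  obtain ⟨j, rfl⟩ := Fin.exists_succ_eq.mpr hi
  exact X_succ_mem_arcIdeal j

variable (d K) in
/-- The ideal of series all of whose monomials have `y`-degree `≥ j`. [folklore] -/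
def degGE (j : ℕ) : Ideal (MvPowerSeries (Fin (d + 1)) K) where
  carrier := {g | ∀ e, yDeg e < j → coeff e g = 0}
  zero_mem' := fun e _ => by simp
  add_mem' := fun {a b} ha hb e he => by simp [ha e he, hb e he]
  smul_mem' := fun c {g} hg e he => by
    classical
    rw [smul_eq_mul, coeff_mul]
    refine Finset.sum_eq_zero fun x hx => ?_
    rw [Finset.mem_antidiagonal] at hx
    have : yDeg x.2 < j := by
      have := congrArg yDeg hx; rw [yDeg_add] at this; omega
    rw [hg x.2 this, mul_zero]

/-- [OURS · L1 W4.2] `mem_degGE_iff` — y-degree / arc-ideal bookkeeping. [folklore] -/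
theorem mem_degGE_iff {j : ℕ} {g : MvPowerSeries (Fin (d + 1)) K} :
    g ∈ degGE d K j ↔ ∀ e, yDeg e < j → coeff e g = 0 := Iff.rfl

/-- [OURS · L1 W4.2] `degGE_zero` — y-degree / arc-ideal bookkeeping. [folklore] -/
theorem degGE_zero : degGE d K 0 = ⊤ := by
  ext g; simp [mem_degGE_iff]

/-- [OURS · L1 W4.2] `degGE_mul_le` — y-degree / arc-ideal bookkeeping. [folklore] -/
theorem degGE_mul_le (i j : ℕ) : degGE d K i * degGE d K j ≤ degGE d K (i + j) := by
  classical
  refine Ideal.mul_le.mpr fun a ha b hb e he => ?_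
  rw [coeff_mul]
  refine Finset.sum_eq_zero fun x hx => ?_
  rw [Finset.mem_antidiagonal] at hx
  have hsum : yDeg x.1 + yDeg x.2 = yDeg e := by rw [← yDeg_add, hx]
  by_cases h1 : yDeg x.1 < i
  · rw [ha x.1 h1, zero_mul]
  · have h2 : yDeg x.2 < j := by omega
    rw [hb x.2 h2, mul_zero]

/-- [OURS · L1 W4.2] `arcIdeal_le_degGE_one` — y-degree / arc-ideal bookkeeping. [folklore] -/
theorem arcIdeal_le_degGE_one : arcIdeal d K ≤ degGE d K 1 := by
  refine Ideal.span_le.mpr ?_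
  rintro _ ⟨i, rfl⟩ e he
  rw [coeff_X]
  rw [if_neg]
  rintro rfl
  simp at he

/-- `P₀^j ⊆ {y-degree ≥ j}`. [folklore] -/
theorem arcIdeal_pow_le_degGE (j : ℕ) : arcIdeal d K ^ j ≤ degGE d K j := by
  induction j with
  | zero => simp [degGE_zero]
  | succ j ih =>
    rw [pow_succ]
    exact (Ideal.mul_mono ih arcIdeal_le_degGE_one).trans (degGE_mul_le j 1)

/-- The `y`-variable to which a monomial of positive `y`-degree is assigned (as an index in `Fin (d+1)`; `0` if none). [folklore] -/
def pick (e : Fin (d + 1) →₀ ℕ) : Fin (d + 1) :=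
  if h : ∃ i : Fin d, e i.succ ≠ 0 then h.choose.succ else 0

/-- [OURS · L1 W4.2] `pick_spec` — y-degree / arc-ideal bookkeeping. [folklore] -/
theorem pick_spec {e : Fin (d + 1) →₀ ℕ} (he : 0 < yDeg e) : pick e ≠ 0 ∧ 0 < e (pick e) := by
  have h := exists_succ_ne_zero_of_yDeg_pos he
  simp only [pick, dif_pos h]
  exact ⟨Fin.succ_ne_zero _, Nat.pos_of_ne_zero h.choose_spec⟩

/-- The partial quotient attached to the variable `X i`: the monomials of `h` assigned to `X i`, divided by `X i`. [folklore] -/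
def part (h : MvPowerSeries (Fin (d + 1)) K) (i : Fin (d + 1)) : MvPowerSeries (Fin (d + 1)) K :=
  fun e' => if pick (e' + single i 1) = i then coeff (e' + single i 1) h else 0

/-- [OURS · L1 W4.2] `coeff_part` — y-degree / arc-ideal bookkeeping. [folklore] -/
theorem coeff_part (h : MvPowerSeries (Fin (d + 1)) K) (i : Fin (d + 1)) (e' : Fin (d + 1) →₀ ℕ) :
    coeff e' (part h i) = if pick (e' + single i 1) = i then coeff (e' + single i 1) h else 0 :=
  rfl

/-- [OURS · L1 W4.2] `coeff_X_mul_part` — y-degree / arc-ideal bookkeeping. [folklore] -/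
theorem coeff_X_mul_part (h : MvPowerSeries (Fin (d + 1)) K) (i : Fin (d + 1)) (e : Fin (d + 1) →₀ ℕ) :
    coeff e (X i * part h i) = if 0 < e i ∧ pick e = i then coeff e h else 0 := by
  have hX1 : (X i : MvPowerSeries (Fin (d + 1)) K) = monomial (single i 1) 1 := by
    rw [← X_pow_eq i 1, pow_one]
  rw [hX1, coeff_monomial_mul, one_mul, coeff_part]
  by_cases hi : 0 < e i
  · have hle : single i 1 ≤ e := by rw [single_le_iff]; exact hi
    have hsub : e - single i 1 + single i 1 = e := tsub_add_cancel_of_le hle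
    rw [if_pos hle, hsub]
    by_cases hp : pick e = i
    · rw [if_pos hp, if_pos ⟨hi, hp⟩]
    · rw [if_neg hp, if_neg (fun h' => hp h'.2)]
  · have hle : ¬ single i 1 ≤ e := by rw [single_le_iff]; omega
    rw [if_neg hle, if_neg (fun h' => hi h'.1)]

/-- **`h = Σ_{i ≠ 0} X_i · part h i`** for a series without `y`-free monomials. [folklore] -/
theorem eq_sum_X_mul_part (h : MvPowerSeries (Fin (d + 1)) K) (H : ∀ e, coeff e h ≠ 0 → 0 < yDeg e) :
    h = ∑ i : Fin d, X i.succ * part h i.succ := by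
  ext e
  rw [map_sum]
  simp_rw [coeff_X_mul_part]
  by_cases he : 0 < yDeg e
  · obtain ⟨hp0, hp⟩ := pick_spec he
    obtain ⟨i₀, hi₀⟩ := Fin.exists_succ_eq.mpr hp0
    rw [Finset.sum_eq_single i₀]
    · rw [hi₀, if_pos ⟨hp, rfl⟩]
    · intro b _ hb
      rw [if_neg]
      rintro ⟨_, hb'⟩
      exact hb (Fin.succ_injective _ (hb'.symm.trans hi₀.symm))
    · simp
  · have h0 : coeff e h = 0 := by
      by_contra hne; exact he (H e hne)
    rw [h0]
    refine (Finset.sum_eq_zero fun i _ => ?_).symm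
    split_ifs with hc
    · rfl
    · rfl

/-- `{y-degree ≥ j} ⊆ P₀^j` (induction on `j` through the decomposition). [folklore] -/
theorem mem_arcIdeal_pow_of_forall_coeff (j : ℕ) :
    ∀ h : MvPowerSeries (Fin (d + 1)) K, (∀ e, coeff e h ≠ 0 → j ≤ yDeg e) → h ∈ arcIdeal d K ^ j := by
  induction j with
  | zero => intro h _; simp
  | succ j ih =>
    intro h H
    have Hpos : ∀ e, coeff e h ≠ 0 → 0 < yDeg e := fun e he => by have := H e he; omega
    have hpart : ∀ i : Fin (d + 1), i ≠ 0 → part h i ∈ arcIdeal d K ^ j := fun i hi => by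
      refine ih _ fun e' he' => ?_
      rw [coeff_part] at he'
      split_ifs at he' with hp
      · have := H _ he'
        rw [yDeg_add, yDeg_single_of_ne_zero hi] at this
        omega
      · exact absurd rfl he'
    have hmul : ∀ i : Fin (d + 1), i ≠ 0 → X i * part h i ∈ arcIdeal d K ^ (j + 1) := fun i hi => by
      rw [pow_succ']
      exact Ideal.mul_mem_mul (X_mem_arcIdeal hi) (hpart i hi)
    rw [eq_sum_X_mul_part h Hpos]
    exact Submodule.sum_mem _ fun i _ => hmul i.succ (Fin.succ_ne_zero i)

/-- **`P₀^j = {y-degree ≥ j}`**: `g ∈ (X_1,…,X_d)^j` iff every monomial of `g` has `y`-degree `≥ j`. [folklore] -/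
theorem mem_arcIdeal_pow_iff {j : ℕ} {g : MvPowerSeries (Fin (d + 1)) K} :
    g ∈ arcIdeal d K ^ j ↔ ∀ e, yDeg e < j → coeff e g = 0 :=
  ⟨fun hg => arcIdeal_pow_le_degGE j hg,
    fun hg => mem_arcIdeal_pow_of_forall_coeff j g fun e he => by by_contra h; exact he (hg e (by omega))⟩

/-- [OURS · L1 W4.2] `arcIdeal_pow_eq_degGE` — y-degree / arc-ideal bookkeeping. [folklore] -/
theorem arcIdeal_pow_eq_degGE (j : ℕ) : arcIdeal d K ^ j = degGE d K j := by
  ext g; exact mem_arcIdeal_pow_iff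

end ArcLimit

end Summit.ResolutionOfSingularities.ResolutionOfSingularities.Cruxes.SigmaMaxModifications.IdeasL1C5

end
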